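import Literature.NumberTheory.Automorphic.LocalStableConjSplitPlace
import Literature.NumberTheory.Automorphic.LocalUnitaryIntegralLevel
import HarnessLib

/-!
# Matching classes at a place SPLIT in `L`: `γ_H → γ` is read at ONE place `w ∣ v`, the matching class is unique,
# `Σ_{[γ]} Δ_v(γ_H, γ) Φ([γ], f)` has ONE term, and `Φ^st_H(γ_H, ·) = Φ([γ_H], ·)` on `H_v = U(Φ₂)_v × U(Φ₁)_v`
(Rogawski (1990), §4.9 p. 54 «if `v` splits in `E`, `G_v ≅ GL₃(E_w)`», §3.1 p. 19, §14.2 p. 232 «for `v` split stable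
conjugacy coincides with conjugacy»; Mok (2015), §1 p. 5)

Topic `NumberTheory/Rogawski1990`; namespaces `Literature.NumberTheory.Automorphic.UnitaryGroup` (§1, generic) and
`Literature.NumberTheory.Rogawski1990` (§2–§4, the CM-local carriers of ★ `Rogawski1990/LocalTransfer`).  THEOREMS ONLY (no
definition, no instance, no notation, no named fact, no `sorry`).  Cell `pub/hodgecm-mathlib`, programme P3a, road «D-N6s» (the
SPLIT-PLACE clause of letter N6 = ★ `LocalTransferUnitExplicitFactor.LocalTransferExplicit`, [Rogawski1990, Prop. 4.9.1 (a)]),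
brick B3 «split bookkeeping on `H_v`» (= gap g2 of A-p13's «D-N7s» census): the class-theoretic half of
`IsLocalDeltaTransfer` (★ `isLocalDeltaTransfer_iff`: `Φ^st_H(γ_H, φ^H) = Σ_{[γ]} Δ_v(γ_H, [γ]) Φ([γ], φ)` for `G`-regular
`γ_H`) at a place `v` of `L⁺` that splits in `L` — there both sides are SINGLE orbital integrals.

* §1 GENERIC (`E∕F` quadratic, `c ≠ 1`, two `c`-hermitian forms `J₁`, `J₂` on `E^N`, `w ∣ v` with `c w ≠ w`, `J_i` invertible at
  `w`; `e_i = localSplitEquiv c J_i …` the `w`-projections ★ `UnitaryGroupSplitPlace`): `isConj_splitInv_splitInv` — the two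
  reconstruction homomorphisms `splitInv_{J₁}`, `splitInv_{J₂} : GL_N(E_w) →* Π_{w′∣v} GL_N(E_{w′})` (★ `splitInv`) have
  CONJUGATE values (at `w̄` they differ by conjugation by `((J₂J₁⁻¹)⁻¹)ᵀ`, ★ `GLn.contragredient` being a homomorphism);
  **`isConj_coe_iff_isConj_localSplitEquiv`** — for `a ∈ U(J₁)(F_v)`, `b ∈ U(J₂)(F_v)`:
  `a ∼ b` in the common ambient `GL_N(E ⊗ F_v)` **iff** `e₁ a ∼ e₂ b` in `GL_N(E_w)` («correspondence between two unitary groups is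
  read at one place above a split `v`»).
* §2 CM (`F = L⁺`, `E = L`, `c` = complex conjugation; `H_v = U(Φ₂)_v × U(Φ₁)_v`, `G′_v = U(H′)_v`, `ι_v = endoEmbLocal`; the
  hermitian∕unit side conditions of the four forms `Φ₃, H′, Φ₂, Φ₁` at `w` are BINDERS `hΦ₃ hΦ₃w …`, discharged by ★
  `antidiagOne_map_transpose`, ★ `isUnit_placeForm_antidiagOne`, ★ `isUnit_placeForm_of_isUnit_det`):
  `localSplitEquiv_endoEmbLocal` — `e₃(ι_v γ_H) = endoGL(e₂ γ_H.1, e₁ γ_H.2)` (★ `map_endoGL`);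
  **`isLocalNormPair_iff_isConj_endoGL_of_split`** — `γ_H → γ ↔ endoGL(e₂ γ_H.1, e₁ γ_H.2) ∼ e′ γ` in `GL₃(L_w)`;
  `exists_isLocalNormPair_of_split` — every `γ_H` has a matching `γ` with `e′ γ = endoGL(e₂ γ_H.1, e₁ γ_H.2)`;
  `isConj_of_isLocalNormPair_of_split` — two matches of one `γ_H` are conjugate IN `U(H′)_v` (★ `isConj_of_exists_conj_of_split`).
* §3 **`finsum_delta_mul_classOrbitalIntegral_eq_of_split`** — for ANY local transfer factor `T` (★ `LocalTransferFactor`: supported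
  on matching pairs, conjugation invariant), any family `mG`, any `f` and a match `γ_H → γ₀`:
  `Σ_{[γ]} T.Δ(γ_H, [γ]) Φ([γ], f) = T.Δ(γ_H, γ₀) · Φ([γ₀], f)`.
* §4 **`stableOrbitalIntegralRel_isLocalStablyConjH_eq_of_split`** — `Φ^st_H(γ_H, f^H) = Φ([γ_H], f^H)` for EVERY `γ_H ∈ H_v` (★
  `isConj_of_isStablyConj_of_split` on each factor).
NOT here: measures, the values of `Δ‴_v` (★ `FinExplicitTransferFactorSplitPlace`), the descent (★ `GLnLeviOrbitalDescent`), the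
transfer of test functions (★ `GLnConstantTermTestFunctions`), the assembly of the N6 clause (brick B5).  HONEST LABEL: HC_CM is proved
only modulo the printed citations until rung 0 closes; this file proves none of them.

## References
* [Rogawski1990] J. D. Rogawski, *Automorphic Representations of Unitary Groups in Three Variables*, Ann. of Math. Stud. 123
  (1990), §3.1 p. 19, §4.3 (4.3.1) p. 43, §4.9 p. 54, §14.2 p. 232.
* [Mok2014] C. P. Mok, *Endoscopic classification of representations of quasi-split unitary groups*, Mem. AMS 235 (2015), §1 p. 5.
* [PlatonovRapinchuk1994] V. Platonov, A. Rapinchuk, *Algebraic Groups and Number Theory* (1994), §2.3, §5.1.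
-/

set_option autoImplicit false

noncomputable section

open NumberField IsDedekindDomain
open scoped Matrix MatrixGroups

/-! ## §1 Generic: conjugacy across two unitary groups at a split place -/

namespace Literature.NumberTheory.Automorphic.UnitaryGroup

section TwoForms

variable {F E : Type} [Field F] [NumberField F] [Field E] [NumberField E] [Algebra F E]
  [Algebra.IsQuadraticExtension F E] (c : E ≃ₐ[F] E) {N : ℕ} (J₁ J₂ : Matrix (Fin N) (Fin N) E)
  {v : HeightOneSpectrum (𝓞 F)} (w : PlacesOver E v)

/-- Conjugacy in a product `Π_i G_i` of groups is componentwise. [cite: PlatonovRapinchuk1994, §2.3] -/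
private theorem isConj_pi_iff {ι : Type*} {G : ι → Type*} [∀ i, Group (G i)] {a b : ∀ i, G i} :
    IsConj a b ↔ ∀ i, IsConj (a i) (b i) := by
  refine ⟨fun h i => (Pi.evalMonoidHom G i).map_isConj h, fun h => ?_⟩
  choose x hx using fun i => isConj_iff.1 (h i)
  exact isConj_iff.2 ⟨fun i => x i, funext fun i => hx i⟩

/-- **The two split reconstructions have conjugate values**: `splitInv_{J₁}(g) ∼ splitInv_{J₂}(g)` in
`Π_{w′∣v} GL_N(E_{w′})` for every `g ∈ GL_N(E_w)` (equal at `w`; at `w̄ = c⁻¹ w` they are the `c⁻¹`-transports of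
`((J_i g J_i⁻¹)⁻¹)ᵀ`, conjugate by `((J₂ J₁⁻¹)⁻¹)ᵀ`). [cite: Rogawski1990, §4.9 p. 54] [cite: Mok2014, §1 Notation p. 5] -/
theorem isConj_splitInv_splitInv (hc : c ≠ 1) (hw : c • w.1 ≠ w.1) (Jw₁ Jw₂ g : GL (Fin N) (w.1.adicCompletion E)) :
    IsConj (splitInv c hc w Jw₁ g) (splitInv c hc w Jw₂ g) := by
  refine isConj_pi_iff.2 fun w' => ?_
  rcases PlacesOver.eq_or_eq_galInv c hc w w' with rfl | rfl
  · rw [splitInv_apply_self, splitInv_apply_self]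
    exact IsConj.refl _
  · rw [splitInv_apply_galInv c hc w hw, splitInv_apply_galInv c hc w hw, splitHat_apply, splitHat_apply]
    refine MonoidHom.map_isConj _ (MonoidHom.map_isConj _ (isConj_iff.2 ⟨Jw₂ * Jw₁⁻¹, ?_⟩))
    group

/-- **In the factor form**: for `a ∈ U(J₁)(F_v)`, `b ∈ U(J₂)(F_v)` inside `Π_{w′∣v} GL_N(E_{w′})` (★ `localPi`), conjugacy
of the `w`-components implies conjugacy (each point is `splitInv` of its `w`-component, ★ `eq_splitInv_of_mem`).
[cite: Rogawski1990, §4.9 p. 54] [cite: Mok2014, §1 Notation p. 5] -/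
theorem isConj_of_isConj_apply_of_split (hc : c ≠ 1) (hw : c • w.1 ≠ w.1) (hJ₁ : (J₁.map c)ᵀ = J₁) (hJ₂ : (J₂.map c)ᵀ = J₂)
    (hJ₁w : IsUnit (placeForm J₁ w.1)) (hJ₂w : IsUnit (placeForm J₂ w.1)) {a b : LocalGLPi E N v}
    (ha : a ∈ localPi E c N J₁ v) (hb : b ∈ localPi E c N J₂ v) (h : IsConj (a w) (b w)) : IsConj a b := by
  obtain ⟨x, hx⟩ := isConj_iff.1 h
  rw [eq_splitInv_of_mem c J₁ hc hJ₁ w hw hJ₁w.unit_spec ha, eq_splitInv_of_mem c J₂ hc hJ₂ w hw hJ₂w.unit_spec hb,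
    ← hx, map_mul, map_mul, map_inv]
  exact (isConj_splitInv_splitInv c w hc hw hJ₁w.unit hJ₂w.unit (a w)).trans
    (isConj_iff.2 ⟨splitInv c hc w hJ₂w.unit x, rfl⟩)

/-- **Conjugacy across two unitary groups is read at one place above a split `v`**: for `a ∈ U(J₁)(F_v)`,
`b ∈ U(J₂)(F_v)` (★ `«local»`, subgroups of the common `GL_N(E ⊗ F_v)`), `a ∼ b` in `GL_N(E ⊗ F_v)` iff `e₁ a ∼ e₂ b` in
`GL_N(E_w)`, `e_i = localSplitEquiv c J_i …` the `w`-projections. [cite: Rogawski1990, §4.9 p. 54] [cite: Mok2014, §1 Notation p. 5] -/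
theorem isConj_coe_iff_isConj_localSplitEquiv (hc : c ≠ 1) (hw : c • w.1 ≠ w.1) (hJ₁ : (J₁.map c)ᵀ = J₁) (hJ₂ : (J₂.map c)ᵀ = J₂)
    (hJ₁w : IsUnit (placeForm J₁ w.1)) (hJ₂w : IsUnit (placeForm J₂ w.1)) (a : «local» E c N J₁ v)
    (b : «local» E c N J₂ v) :
    IsConj (a : GL (Fin N) (LocalRing E v)) (b : GL (Fin N) (LocalRing E v)) ↔
      IsConj (localSplitEquiv c J₁ hc hJ₁ w hw hJ₁w a) (localSplitEquiv c J₂ hc hJ₂ w hw hJ₂w b) := by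
  rw [localSplitEquiv_apply_eq, localSplitEquiv_apply_eq]
  refine ⟨fun h => ?_, fun h => ?_⟩
  · exact ((Pi.evalMonoidHom (fun w' : PlacesOver E v => GL (Fin N) (w'.1.adicCompletion E)) w).comp
      (localGLPiEquiv E N v).toMonoidHom).map_isConj h
  · have h2 := isConj_of_isConj_apply_of_split c J₁ J₂ w hc hw hJ₁ hJ₂ hJ₁w hJ₂w
      ((localGLPiEquiv_mem_localPi_iff E c N J₁ v _).2 a.2) ((localGLPiEquiv_mem_localPi_iff E c N J₂ v _).2 b.2) h
    have h3 := (localGLPiEquiv E N v).symm.toMulEquiv.toMonoidHom.map_isConj h2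
    have ha : (localGLPiEquiv E N v).symm.toMulEquiv.toMonoidHom (localGLPiEquiv E N v (a : GL (Fin N) (LocalRing E v))) =
        (a : GL (Fin N) (LocalRing E v)) := (localGLPiEquiv E N v).symm_apply_apply _
    have hb : (localGLPiEquiv E N v).symm.toMulEquiv.toMonoidHom (localGLPiEquiv E N v (b : GL (Fin N) (LocalRing E v))) =
        (b : GL (Fin N) (LocalRing E v)) := (localGLPiEquiv E N v).symm_apply_apply _
    rwa [ha, hb] at h3

/-- **Regularity is read at `w`**: if `u ∈ U(J)(F_v)` is regular semisimple in `GL_N(E ⊗ F_v)` (★ `IsRegularElt`: separable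
characteristic polynomial over `Π_{w′∣v} E_{w′}`), then `e u ∈ GL_N(E_w)` is regular semisimple (the characteristic
polynomial of `e u` is the `w`-component, ★ `coe_localSplitEquiv_apply`, cf. ★ `charpoly_localSplitEquiv`). [cite: Rogawski1990, §3.1 p. 19; §4.9 p. 54] -/
theorem isRegularElt_localSplitEquiv_of_isRegularElt (J : Matrix (Fin N) (Fin N) E) (hc : c ≠ 1) (hw : c • w.1 ≠ w.1)
    (hJ : (J.map c)ᵀ = J) (hJw : IsUnit (placeForm J w.1)) (u : «local» E c N J v)
    (hu : Rogawski1990.IsRegularElt (u : GL (Fin N) (LocalRing E v))) :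
    Rogawski1990.IsRegularElt (localSplitEquiv c J hc hJ w hw hJw u) := by
  rw [Rogawski1990.isRegularElt_iff, coe_localSplitEquiv_apply, Matrix.charpoly_map]
  exact hu.map

end TwoForms

end Literature.NumberTheory.Automorphic.UnitaryGroup

/-! ## §2 CM: the matching relation `γ_H → γ` at a split place -/

namespace Literature.NumberTheory.Rogawski1990

open Literature.NumberTheory.Automorphic Literature.NumberTheory.Automorphic.UnitaryGroup

section CM

variable (L : Type) [Field L] [NumberField L] [IsCMField L] (H' : Matrix (Fin 3) (Fin 3) L)
  {v : HeightOneSpectrum (𝓞 ↥(maximalRealSubfield L))} (hc : IsCMField.complexConj L ≠ 1)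
  (w : UnitaryGroup.PlacesOver L v) (hw : IsCMField.complexConj L • w.1 ≠ w.1)
  (hΦ₂ : ((Matrix.of fun i j : Fin 2 => if i.val + j.val + 1 = 2 then (1 : L) else 0).map (IsCMField.complexConj L))ᵀ =
    Matrix.of fun i j : Fin 2 => if i.val + j.val + 1 = 2 then (1 : L) else 0)
  (hΦ₂w : IsUnit (placeForm (Matrix.of fun i j : Fin 2 => if i.val + j.val + 1 = 2 then (1 : L) else 0) w.1))
  (hΦ₁ : ((Matrix.of fun i j : Fin 1 => if i.val + j.val + 1 = 1 then (1 : L) else 0).map (IsCMField.complexConj L))ᵀ =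
    Matrix.of fun i j : Fin 1 => if i.val + j.val + 1 = 1 then (1 : L) else 0)
  (hΦ₁w : IsUnit (placeForm (Matrix.of fun i j : Fin 1 => if i.val + j.val + 1 = 1 then (1 : L) else 0) w.1))
  (hH' : (H'.map (IsCMField.complexConj L))ᵀ = H') (hH'w : IsUnit (placeForm H' w.1))

/-- **`e₃(ι_v γ_H) = endoGL(e₂ γ_H.1, e₁ γ_H.2)`**: the `w`-projection of the endoscopic embedding is the endoscopic pattern of the
`w`-projections (`e` is `GL₃` of the evaluation `E ⊗ F_v → L_w`, ★ `map_endoGL`). [cite: Rogawski1990, §4.8 Case (a) p. 53; §4.9 p. 54] -/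
theorem localSplitEquiv_endoEmbLocal
    (hΦ₃ : ((Matrix.of fun i j : Fin 3 => if i.val + j.val + 1 = 3 then (1 : L) else 0).map (IsCMField.complexConj L))ᵀ =
      Matrix.of fun i j : Fin 3 => if i.val + j.val + 1 = 3 then (1 : L) else 0)
    (hΦ₃w : IsUnit (placeForm (Matrix.of fun i j : Fin 3 => if i.val + j.val + 1 = 3 then (1 : L) else 0) w.1))
    (γH : (UnitaryGroup.cmDatum L 2 (Matrix.of fun i j : Fin 2 => if i.val + j.val + 1 = 2 then (1 : L) else 0)).Local v ×
      (UnitaryGroup.cmDatum L 1 (Matrix.of fun i j : Fin 1 => if i.val + j.val + 1 = 1 then (1 : L) else 0)).Local v) :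
    localSplitEquiv (IsCMField.complexConj L) _ hc hΦ₃ w hw hΦ₃w (endoEmbLocal L v γH) =
      endoGL (localSplitEquiv (IsCMField.complexConj L) _ hc hΦ₂ w hw hΦ₂w γH.1,
        localSplitEquiv (IsCMField.complexConj L) _ hc hΦ₁ w hw hΦ₁w γH.2) := by
  refine Units.ext ?_
  rw [coe_localSplitEquiv_apply]
  have h := congrArg (fun g : GL (Fin 3) (w.1.adicCompletion L) => (g : Matrix (Fin 3) (Fin 3) (w.1.adicCompletion L)))
    (map_endoGL (Pi.evalRingHom (fun w' : UnitaryGroup.PlacesOver L v => w'.1.adicCompletion L) w)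
      ((γH.1.val : GL (Fin 2) (UnitaryGroup.LocalRing L v)), (γH.2.val : GL (Fin 1) (UnitaryGroup.LocalRing L v))))
  exact h

/-- **`γ_H → γ` read at `w`**: `IsLocalNormPair L H′ v γ_H γ` (★: `ι_v(γ_H)` and `γ` conjugate in the common `GL₃(L ⊗ L⁺_v)`) holds iff
`endoGL(e₂ γ_H.1, e₁ γ_H.2) ∼ e′ γ` in `GL₃(L_w)`. [cite: Rogawski1990, §4.9 p. 54; §14.1 p. 232] [cite: Mok2014, §1 Notation p. 5] -/
theorem isLocalNormPair_iff_isConj_endoGL_of_split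
    (γH : (UnitaryGroup.cmDatum L 2 (Matrix.of fun i j : Fin 2 => if i.val + j.val + 1 = 2 then (1 : L) else 0)).Local v ×
      (UnitaryGroup.cmDatum L 1 (Matrix.of fun i j : Fin 1 => if i.val + j.val + 1 = 1 then (1 : L) else 0)).Local v)
    (γ : (UnitaryGroup.cmDatum L 3 H').Local v) :
    IsLocalNormPair L H' v γH γ ↔
      IsConj (endoGL (localSplitEquiv (IsCMField.complexConj L) _ hc hΦ₂ w hw hΦ₂w γH.1,
          localSplitEquiv (IsCMField.complexConj L) _ hc hΦ₁ w hw hΦ₁w γH.2))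
        (localSplitEquiv (IsCMField.complexConj L) H' hc hH' w hw hH'w γ) := by
  rw [← localSplitEquiv_endoEmbLocal L hc w hw hΦ₂ hΦ₂w hΦ₁ hΦ₁w (antidiagOne_map_transpose (IsCMField.complexConj L) 3)
    (isUnit_placeForm_antidiagOne (E := L) 3 w.1) γH]
  exact isConj_coe_iff_isConj_localSplitEquiv (IsCMField.complexConj L) _ H' w hc hw
    (antidiagOne_map_transpose (IsCMField.complexConj L) 3) hH' (isUnit_placeForm_antidiagOne (E := L) 3 w.1) hH'w
    (endoEmbLocal L v γH) γ

/-- **`G`-regularity read at `w`**: a `G`-regular `γ_H ∈ H_v` (★ `IsLocalGRegular`: `ι_v(γ_H)` regular semisimple in `GL₃(L ⊗ L⁺_v)`) has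
`endoGL(e₂ γ_H.1, e₁ γ_H.2) ∈ GL₃(L_w)` regular semisimple (separable characteristic polynomial). [cite: Rogawski1990, §4.3 p. 42; §4.9 p. 54] -/
theorem isRegularElt_endoGL_of_isLocalGRegular_of_split
    (γH : (UnitaryGroup.cmDatum L 2 (Matrix.of fun i j : Fin 2 => if i.val + j.val + 1 = 2 then (1 : L) else 0)).Local v ×
      (UnitaryGroup.cmDatum L 1 (Matrix.of fun i j : Fin 1 => if i.val + j.val + 1 = 1 then (1 : L) else 0)).Local v)
    (hreg : IsLocalGRegular L v γH) :
    IsRegularElt (endoGL (localSplitEquiv (IsCMField.complexConj L) _ hc hΦ₂ w hw hΦ₂w γH.1,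
      localSplitEquiv (IsCMField.complexConj L) _ hc hΦ₁ w hw hΦ₁w γH.2)) := by
  rw [← localSplitEquiv_endoEmbLocal L hc w hw hΦ₂ hΦ₂w hΦ₁ hΦ₁w (antidiagOne_map_transpose (IsCMField.complexConj L) 3)
    (isUnit_placeForm_antidiagOne (E := L) 3 w.1) γH]
  exact isRegularElt_localSplitEquiv_of_isRegularElt (IsCMField.complexConj L) w _ hc hw _ _ (endoEmbLocal L v γH) hreg

/-- **At a split place every `γ_H ∈ H_v` has a match in `G′_v = U(H′)_v`**, namely `γ := e′⁻¹(endoGL(e₂ γ_H.1, e₁ γ_H.2))`.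
[cite: Rogawski1990, §4.9 p. 54] [cite: Mok2014, §1 Notation p. 5] -/
theorem exists_isLocalNormPair_of_split
    (γH : (UnitaryGroup.cmDatum L 2 (Matrix.of fun i j : Fin 2 => if i.val + j.val + 1 = 2 then (1 : L) else 0)).Local v ×
      (UnitaryGroup.cmDatum L 1 (Matrix.of fun i j : Fin 1 => if i.val + j.val + 1 = 1 then (1 : L) else 0)).Local v) :
    ∃ γ : (UnitaryGroup.cmDatum L 3 H').Local v, IsLocalNormPair L H' v γH γ ∧
      localSplitEquiv (IsCMField.complexConj L) H' hc hH' w hw hH'w γ =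
        endoGL (localSplitEquiv (IsCMField.complexConj L) _ hc hΦ₂ w hw hΦ₂w γH.1,
          localSplitEquiv (IsCMField.complexConj L) _ hc hΦ₁ w hw hΦ₁w γH.2) := by
  refine ⟨(localSplitEquiv (IsCMField.complexConj L) H' hc hH' w hw hH'w).symm
    (endoGL (localSplitEquiv (IsCMField.complexConj L) _ hc hΦ₂ w hw hΦ₂w γH.1,
      localSplitEquiv (IsCMField.complexConj L) _ hc hΦ₁ w hw hΦ₁w γH.2)), ?_, ?_⟩
  · rw [isLocalNormPair_iff_isConj_endoGL_of_split L H' hc w hw hΦ₂ hΦ₂w hΦ₁ hΦ₁w hH' hH'w,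
      ContinuousMulEquiv.apply_symm_apply]
  · exact ContinuousMulEquiv.apply_symm_apply _ _

/-- **The matching class is unique at a split place**: two matches `γ`, `γ′` of one `γ_H` are conjugate IN `U(H′)_v` (they are
conjugate in `GL₃(L ⊗ L⁺_v)` by transitivity, and at a split place that is conjugacy, ★ `isConj_of_exists_conj_of_split`).
[cite: Rogawski1990, §14.2 p. 232; §3.1 p. 19] -/
theorem isConj_of_isLocalNormPair_of_split (hH' : (H'.map (IsCMField.complexConj L))ᵀ = H') (w : UnitaryGroup.PlacesOver L v)
    (hw : IsCMField.complexConj L • w.1 ≠ w.1) (hH'w : IsUnit (placeForm H' w.1))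
    {γH : (UnitaryGroup.cmDatum L 2 (Matrix.of fun i j : Fin 2 => if i.val + j.val + 1 = 2 then (1 : L) else 0)).Local v ×
      (UnitaryGroup.cmDatum L 1 (Matrix.of fun i j : Fin 1 => if i.val + j.val + 1 = 1 then (1 : L) else 0)).Local v}
    {γ γ' : (UnitaryGroup.cmDatum L 3 H').Local v} (h : IsLocalNormPair L H' v γH γ) (h' : IsLocalNormPair L H' v γH γ') :
    IsConj γ γ' := by
  have hγγ' : IsConj (γ.val : GL (Fin 3) (UnitaryGroup.LocalRing L v)) (γ'.val : GL (Fin 3) (UnitaryGroup.LocalRing L v)) :=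
    (IsConj.symm h).trans h'
  exact isConj_of_exists_conj_of_split (IsCMField.complexConj L) H' (IsCMField.complexConj_ne_one L) hH' w hw hH'w γ γ'
    (isConj_iff.1 hγγ')

/-! ## §3 The `G`-side sum has one term -/

/-- **`Σ_{[γ]} Δ_v(γ_H, [γ]) Φ([γ], f) = Δ_v(γ_H, γ₀) · Φ([γ₀], f)` at a split place**, for ANY local transfer factor `T` (★
`LocalTransferFactor`: `Δ_v = 0` off the matching pairs, `Δ_v(γ_H, y γ y⁻¹) = Δ_v(γ_H, γ)`), ANY orbital measure family `mG`, any `f`,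
and a match `γ_H → γ₀`: the only class carrying a non-zero factor is `[γ₀]` (uniqueness of the matching class), and at it
`Δ_v(γ_H, out [γ₀]) = Δ_v(γ_H, γ₀)`. [cite: Rogawski1990, §4.3 (4.3.1)–(4.3.2) p. 43; §4.9 p. 54] -/
theorem finsum_delta_mul_classOrbitalIntegral_eq_of_split (hH' : (H'.map (IsCMField.complexConj L))ᵀ = H')
    (w : UnitaryGroup.PlacesOver L v) (hw : IsCMField.complexConj L • w.1 ≠ w.1) (hH'w : IsUnit (placeForm H' w.1))
    {_hγ : ∀ γ : (UnitaryGroup.cmDatum L 3 H').Local v,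
      MeasurableSpace ((UnitaryGroup.cmDatum L 3 H').Local v ⧸ Subgroup.centralizer ({γ} : Set ((UnitaryGroup.cmDatum L 3 H').Local v)))}
    (T : LocalTransferFactor L H' v) (mG : OrbitalMeasureFamily ((UnitaryGroup.cmDatum L 3 H').Local v))
    (f : (UnitaryGroup.cmDatum L 3 H').Local v → ℂ)
    {γH : (UnitaryGroup.cmDatum L 2 (Matrix.of fun i j : Fin 2 => if i.val + j.val + 1 = 2 then (1 : L) else 0)).Local v ×
      (UnitaryGroup.cmDatum L 1 (Matrix.of fun i j : Fin 1 => if i.val + j.val + 1 = 1 then (1 : L) else 0)).Local v}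
    {γ₀ : (UnitaryGroup.cmDatum L 3 H').Local v} (h₀ : IsLocalNormPair L H' v γH γ₀) :
    ∑ᶠ c : ConjClasses ((UnitaryGroup.cmDatum L 3 H').Local v), T.Δ γH (Quotient.out c) * classOrbitalIntegral mG f c =
      T.Δ γH γ₀ * classOrbitalIntegral mG f (ConjClasses.mk γ₀) := by
  rw [finsum_eq_single (fun c : ConjClasses ((UnitaryGroup.cmDatum L 3 H').Local v) =>
    T.Δ γH (Quotient.out c) * classOrbitalIntegral mG f c) (ConjClasses.mk γ₀)]
  · -- the value at `[γ₀]`: `out [γ₀] = y γ₀ y⁻¹`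
    obtain ⟨y, hy⟩ := isConj_iff.1 (ConjClasses.mk_eq_mk_iff_isConj.1 (Quotient.out_eq (ConjClasses.mk γ₀)).symm)
    change T.Δ γH (Quotient.out (ConjClasses.mk γ₀)) * _ = _
    rw [← hy, T.conj_right]
  · intro c hne
    have hΔ : T.Δ γH (Quotient.out c) = 0 := by
      refine T.eq_zero_of_not_rel _ _ fun hrel => hne ?_
      have h1 : ConjClasses.mk γ₀ = ConjClasses.mk (Quotient.out c) :=
        ConjClasses.mk_eq_mk_iff_isConj.2 (isConj_of_isLocalNormPair_of_split L H' hH' w hw hH'w h₀ hrel)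
      rw [h1]
      exact (Quotient.out_eq c).symm
    rw [hΔ, zero_mul]

/-! ## §4 The `H`-side stable orbital integral is a single orbital integral -/

omit [NumberField L] [IsCMField L] in
/-- Conjugacy in `H_v = U(Φ₂)_v × U(Φ₁)_v` from conjugacy of the components. [cite: Rogawski1990, §3.1 p. 19] -/
private theorem isConj_prod_of_isConj {A B : Type*} [Group A] [Group B] {a a' : A} {b b' : B} (ha : IsConj a a')
    (hb : IsConj b b') : IsConj (a, b) (a', b') := by
  obtain ⟨x, hx⟩ := isConj_iff.1 ha
  obtain ⟨y, hy⟩ := isConj_iff.1 hb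
  exact isConj_iff.2 ⟨(x, y), Prod.ext hx hy⟩

/-- **At a split place `Φ^st_H(γ_H, f^H) = Φ([γ_H], f^H)` for EVERY `γ_H ∈ H_v`**, every family of orbital measures and every `f^H`:
stable conjugacy in `H_v` (★ `IsLocalStablyConjH`, componentwise `GL`-conjugacy) is conjugacy at a split place (★
`isConj_of_isStablyConj_of_split` on each factor `U(Φ₂)_v`, `U(Φ₁)_v`), so the defining `finsum` (★ `stableOrbitalIntegralRel`) runs over
the single class `[γ_H]`. [cite: Rogawski1990, §14.2 p. 232; §4.1 (4.1.1) p. 40] -/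
theorem stableOrbitalIntegralRel_isLocalStablyConjH_eq_of_split (w : UnitaryGroup.PlacesOver L v)
    (hw : IsCMField.complexConj L • w.1 ≠ w.1)
    (hΦ₂' : ((Matrix.of fun i j : Fin 2 => if i.val + j.val + 1 = 2 then (1 : L) else 0).map (cmConjRingHom L))ᵀ =
      Matrix.of fun i j : Fin 2 => if i.val + j.val + 1 = 2 then (1 : L) else 0)
    (hΦ₂d : (Matrix.of fun i j : Fin 2 => if i.val + j.val + 1 = 2 then (1 : L) else 0).det ≠ 0)
    (hΦ₁' : ((Matrix.of fun i j : Fin 1 => if i.val + j.val + 1 = 1 then (1 : L) else 0).map (cmConjRingHom L))ᵀ =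
      Matrix.of fun i j : Fin 1 => if i.val + j.val + 1 = 1 then (1 : L) else 0)
    (hΦ₁d : (Matrix.of fun i j : Fin 1 => if i.val + j.val + 1 = 1 then (1 : L) else 0).det ≠ 0)
    {_ha : ∀ a : ((UnitaryGroup.cmDatum L 2 (Matrix.of fun i j : Fin 2 => if i.val + j.val + 1 = 2 then (1 : L) else 0)).Local v ×
        (UnitaryGroup.cmDatum L 1 (Matrix.of fun i j : Fin 1 => if i.val + j.val + 1 = 1 then (1 : L) else 0)).Local v),
      MeasurableSpace (((UnitaryGroup.cmDatum L 2 (Matrix.of fun i j : Fin 2 => if i.val + j.val + 1 = 2 then (1 : L) else 0)).Local v ×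
        (UnitaryGroup.cmDatum L 1 (Matrix.of fun i j : Fin 1 => if i.val + j.val + 1 = 1 then (1 : L) else 0)).Local v) ⧸
        Subgroup.centralizer ({a} : Set ((UnitaryGroup.cmDatum L 2 (Matrix.of fun i j : Fin 2 => if i.val + j.val + 1 = 2 then (1 : L) else 0)).Local v ×
        (UnitaryGroup.cmDatum L 1 (Matrix.of fun i j : Fin 1 => if i.val + j.val + 1 = 1 then (1 : L) else 0)).Local v)))}
    (mH : OrbitalMeasureFamily ((UnitaryGroup.cmDatum L 2 (Matrix.of fun i j : Fin 2 => if i.val + j.val + 1 = 2 then (1 : L) else 0)).Local v ×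
        (UnitaryGroup.cmDatum L 1 (Matrix.of fun i j : Fin 1 => if i.val + j.val + 1 = 1 then (1 : L) else 0)).Local v))
    (fH : ((UnitaryGroup.cmDatum L 2 (Matrix.of fun i j : Fin 2 => if i.val + j.val + 1 = 2 then (1 : L) else 0)).Local v ×
        (UnitaryGroup.cmDatum L 1 (Matrix.of fun i j : Fin 1 => if i.val + j.val + 1 = 1 then (1 : L) else 0)).Local v) → ℂ)
    (γH : (UnitaryGroup.cmDatum L 2 (Matrix.of fun i j : Fin 2 => if i.val + j.val + 1 = 2 then (1 : L) else 0)).Local v ×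
      (UnitaryGroup.cmDatum L 1 (Matrix.of fun i j : Fin 1 => if i.val + j.val + 1 = 1 then (1 : L) else 0)).Local v) :
    stableOrbitalIntegralRel (IsLocalStablyConjH L v) mH fH γH = classOrbitalIntegral mH fH (ConjClasses.mk γH) := by
  have hset : {c : ConjClasses ((UnitaryGroup.cmDatum L 2 (Matrix.of fun i j : Fin 2 => if i.val + j.val + 1 = 2 then (1 : L) else 0)).Local v ×
        (UnitaryGroup.cmDatum L 1 (Matrix.of fun i j : Fin 1 => if i.val + j.val + 1 = 1 then (1 : L) else 0)).Local v) |
      IsLocalStablyConjH L v γH (Quotient.out c)} = {ConjClasses.mk γH} := by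
    ext c
    simp only [Set.mem_setOf_eq, Set.mem_singleton_iff]
    constructor
    · intro hst
      have h1 : IsConj γH (Quotient.out c) :=
        isConj_prod_of_isConj
          (isConj_of_isStablyConj_of_split L 2 _ hΦ₂' hΦ₂d w hw γH.1 (Quotient.out c).1 hst.1)
          (isConj_of_isStablyConj_of_split L 1 _ hΦ₁' hΦ₁d w hw γH.2 (Quotient.out c).2 hst.2)
      rw [ConjClasses.mk_eq_mk_iff_isConj.2 h1]
      exact (Quotient.out_eq c).symm
    · rintro rfl
      exact isStablyConjH_of_isConj (ConjClasses.mk_eq_mk_iff_isConj.1 (Quotient.out_eq (ConjClasses.mk γH))).symm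
  rw [stableOrbitalIntegralRel_def]
  exact (finsum_mem_congr hset fun _ _ => rfl).trans finsum_mem_singleton

end CM

end Literature.NumberTheory.Rogawski1990

end
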